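import Summits.CriticalPhenomena.SAWScalingLimit.Theses.SAWSpinMonotone
import Summits.CriticalPhenomena.SAWScalingLimit.Theorems.SAWSpinMonotoneQCIdentificationDefs

/-!
# Disproof of `QCIdentification` (stmt-CriticalPhenomena-16772, route SAWSpinMonotone) — findings

Crux: `QCIdentification := (K) → (M) → HexObservableLimit`, where (K) = `NoFoldBound` and
(M) = `InteriorFlattening` of the sibling route SAWDevelopingMap VERBATIM (`crux_iff_sibling`,
`Iff.rfl`; the Defs module's `sameNode`), and the conclusion is the repaired, doubly-pinned DCS
Conjecture 2 (item stmt-14003, `target_iff_sibling`).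

## Verdict of this cycle (cdisprove, cycle 1, 2026-08-17): NO KILL; the crux resists for cause.

1. LOGICAL SHAPE. `¬ QCIdentification ↔ (K) ∧ (M) ∧ ¬ HexObservableLimit` (`not_crux_iff`): an
   unconditional refutation needs BOTH open lattice statements proved AND the typed DCS Conjecture 2
   refuted. The conclusion alone gives the crux (`crux_of_target`). Dropping a hypothesis gives the
   statements `WithoutK := (M) → T`, `WithoutM := (K) → T` (§2); their negations are `(M) ∧ ¬T`,
   `(K) ∧ ¬T` (`not_withoutK_iff`, `not_withoutM_iff`) — so NO `_false_without_<H>` theorem is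
   available for this crux without settling an open problem; both hypotheses are recorded as
   load-bearing only in the informal sense below.
2. VACUITY (are (K), (M) satisfiable?). Exact enumeration this seat (C, `exp/cjob/hexobs.c`, double
   precision, DCS-mode residual ≤ 1e-13 as a convention check): ALL hole-free fixed polyhexes with
   ≤ 9 cells (94 373 domains, 1 813 812 (domain, source) pairs for 8–9 cells alone), all honeycomb site
   animals with ≤ 10 vertices (7 917), the 19-cell ball, every boundary source, every vertex:
   max Beltrami/sum ratio 0.6816 (ball), 0.6801 (9 cells); animals ≤ 13 vertices (2.2·10⁶ pairs):
   0.6605. In EVERY polyhex/ball pair (> 1.9·10⁶) the arg-max vertex IS THE SOURCE VERTEX `v_a`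
   (thin animals have off-source maxima, by ≤ 0.042, all below the fat-domain source values).
   At the source the triple is exactly
   `(1, x e^{-5πi/24} + L e^{-5πi/6}, conj)` (first step or returning loop, rigid loop winding `4π/3`),
   ratio `r(L) = (β_T + √3 L)/(α_T - √3 L)`, `L = x_c · Z_Λ`, `Z_Λ` = critical returning-loop series;
   fold iff `Z ≥ sin(π/8) = 0.38268` (`source_fold_threshold`, proved below). Loop census in the
   maximal domain (plane minus a straight slit behind `u_a`, `exp/cjob/loops.c`): `Z(≤43 vertices)
   = 0.09781` (2.0·10⁸ loops of 43 vertices), terms `∝ n^{-1.76}`, extrapolated `Z_∞ ≈ 0.117`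
   (0.11–0.15 under pessimistic exponent drift) ⇒ sup ratio ≈ 0.715 < 1. Truncated half-plane
   enumeration (`nearsrc.c`, walks ≤ 22 steps, 1.7·10⁶ walks): source 0.683↑, neighbours 0.588, 0.480,
   depth-2 row ≤ 0.31; near a slit tip (`nearslit.c`) nothing exceeds the source. So (K) is
   numerically TRUE with `k ≈ 0.72` and the crux is NOT vacuous; (M) is the open analytic half
   (sibling InteriorFlattening Disproof gen-2: `|μ_v| = 0.397…0.138` at depth 2…8, rate ≈ C/R).
3. TARGET. `HexObservableLimit` (14003) has satisfiable hypotheses (half-disc instance vocabulary of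
   `BoundaryClosureNegative_*` adapts: both marked points on the flat diameter, `ρ ≤ 1/4`), divides only
   by `F(b_δ) ≠ 0` (rigid winding, `Nonempty`), finsum over a finite mid-edge set (no junk). Mirror
   symmetry of admissible data (`z ↦ -conj z`, `Φ ↦ -conj Φ`) forces the universal `c` to be REAL;
   consistent (local limit at `b` forgets the side of `a`: the common rigid phase `e^{-iσW_ab}` cancels
   in `F(e)/F(b_δ)`). No cheap witness: collar decorations away from the two rigid balls are
   exponentially invisible to walks `a → bulk` (width-1 dead ends admit no SAW transit).

## Line `eight_fifths_primitive` (PICKED 2026-08-17) — stub-by-stub (`-- Targets` below)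

* `stub_boundaryPhaseLaw`, `stub_rayRigidity`: LANDED by the lead
  (`Theorems/SAWSpinMonotoneQCIdentification{BoundaryPhaseLaw,RayRigidity}.lean`). My independent
  checks agree: BPL residual ≤ 4e-13 in all 1.9·10⁶ enumerated pairs; RayRigidity proof = odd Schwarz
  reflection of `Im(e^{-iθ}G∘Φ⁻¹) - κ`, harmonic Liouville at linear growth, `Q = αw + β`.
* `stub_noBranching : NoFoldBound → NoBranching`: COULD NOT BREAK — 32.6·10⁶ interior-hexagon
  instances (all the domains above), arg-sum identically 0 (|Σ| ≤ 3e-16). WHY IT RESISTS (turning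
  budget, for the lead): with the exact boundary phase law the image direction of the boundary
  `𝕋`-edge dual to `p ≠ a` is `(3/8)τ_p + (5/8)(τ_a + π)` (`τ` cumulative ccw tangent angle), so the
  principal exterior angles of `H(∂K_Λ)` sum to `(3/8)(2π - ε_L - ε_R)` off the source edge plus
  `5π/8 + (3/8)ε_R` and `5π/8 + (3/8)ε_L` at its two corners (`F(a) = 1`): TOTAL EXACTLY `2π`.
  Under (K) every triangle of the source component is non-degenerate and positively oriented
  (a triangle with `S_v = 0` has `B_v = 0`, maps to a point, forces rank ≤ 1 hence `|B| = |S|` on each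
  neighbour, so by (K) the whole component would be constant, contradicting `F(a) = 1`), image angles
  lie in `(0, π)`, non-reflex boundary vertices carry no excess, and PL Gauss–Bonnet gives
  `Σ_int (m_x - 1) + Σ_reflex j_x = (2π - 2π)/2π = 0`: no interior branching (and none at reflex
  boundary vertices). Checked on the single triangle: exterior angles 157.5°, 45°, 157.5°.
* `stub_subsequentialLimits`, `stub_rayCondition`, `stub_lateralUniversality`,
  `stub_boundaryAmplitude`: continuum / local-limit statements; junk probes all negative —
  `bulkAverage` is a genuine finite sum; `ν ≡ 0` is excluded by `shapeIntegral ≠ 0` for a bump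
  against `conj` of the density; the `≠ 0 somewhere` + `ContinuousOn` guards exclude the zero density;
  `RaySolution` forces `g` zero-free holomorphic (consistent with `(Φ')^{5/8}`); its linear-growth
  clause is load-bearing (`G = Φ³` is a ray solution without it — refutable in Lean once an
  `Admissible` instance is assembled from `BoundaryClosureNegative_Instance`; not done: the lead
  already designs around it); `BoundaryAmplitude`'s universal `κ` must be real by the mirror
  argument, consistent with a side-forgetting local limit at `b` (= the content of (N1)+(N2));
  `ZigzagLateralUniversality` tolerates `F(p') = 0` (disconnected `Λ`: `0 ≤ 0`) and the
  `a`-closer-to-`p'` geometry (`(1-η)^{5/4}` relative error, absorbed by `η(ε)`).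
  No stub of the cut is currently suspected false; the open content is `stub_rayCondition`.

## Dead ends (one line each)
* boundary vertices cannot fold: rigid slit-tip winding forces the `-2π/3` branch, ratio ≤ β_T/α_T·1
  (the `+4π/3` branch, ratio 2.29, needs a ring: sibling `Ring12Refutation`, not simply connected);
* exact vanishing `S_v = 0` at a reachable vertex would need a cancellation in `ℚ(ζ₄₈)` (all weights
  live there: `x_c = √2 sin(π/8)`); two walks cancel iff equal length and turn counts differ by
  24 mod 48 — impossible below 24 turns; none found;
* ψ-averaging kills a pure `(1, ω, ω²)` orientation mode of any pointwise limit (`1 + ω + ω² = 0`), so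
  the averaged target is weaker than pointwise Conj. 2, not stronger.
-/

noncomputable section

open Literature.Probability.LatticeModels Literature.Probability.RandomPlanarGeometry
open Literature.Probability.RandomPlanarGeometry.SAW
open Summit.CriticalPhenomena.SAWScalingLimit.Theses.SAWSpinMonotone

namespace Summit.CriticalPhenomena.SAWScalingLimit.Cruxes.QCIdentification.Disproof

/-! ## §1 Logical shape of the crux -/

/-- The crux is, by `rfl`, the sibling crux stmt-8298 of route SAWDevelopingMap. -/
theorem crux_iff_sibling :
    QCIdentification ↔
      (Summit.CriticalPhenomena.SAWScalingLimit.Theses.SAWDevelopingMap.NoFoldBound →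
        Summit.CriticalPhenomena.SAWScalingLimit.Theses.SAWDevelopingMap.InteriorFlattening →
          HexObservableLimit) :=
  Iff.rfl

/-- The conclusion is, by `rfl`, the shared target stmt-14003 as spelled in SAWDevelopingMap. -/
theorem target_iff_sibling :
    HexObservableLimit ↔
      Summit.CriticalPhenomena.SAWScalingLimit.Theses.SAWDevelopingMap.HexObservableLimit :=
  Iff.rfl

/-- Sandwich, upper side: the target alone proves the crux. -/
theorem crux_of_target (h : HexObservableLimit) : QCIdentification := fun _ _ => h

/-- What an unconditional kill costs: both open lattice statements AND the negation of the typed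
DCS Conjecture 2. -/
theorem not_crux_iff :
    ¬ QCIdentification ↔
      (Summit.CriticalPhenomena.SAWScalingLimit.Theses.SAWDevelopingMap.NoFoldBound ∧
        Summit.CriticalPhenomena.SAWScalingLimit.Theses.SAWDevelopingMap.InteriorFlattening ∧
          ¬ HexObservableLimit) := by
  constructor
  · intro h
    by_contra h'
    exact h fun hK hM => by_contra fun hT => h' ⟨hK, hM, hT⟩
  · rintro ⟨hK, hM, hT⟩ h
    exact hT (h hK hM)

/-! ## §2 Load-bearing hypotheses (informal sense only — see the module docstring, item 1) -/

/-- The crux with hypothesis (K) dropped. -/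
def QCIdentificationWithoutK : Prop :=
  Summit.CriticalPhenomena.SAWScalingLimit.Theses.SAWDevelopingMap.InteriorFlattening →
    HexObservableLimit

/-- The crux with hypothesis (M) dropped. -/
def QCIdentificationWithoutM : Prop :=
  Summit.CriticalPhenomena.SAWScalingLimit.Theses.SAWDevelopingMap.NoFoldBound → HexObservableLimit

/-- Dropping (K) strengthens the crux. -/
theorem crux_of_withoutK (h : QCIdentificationWithoutK) : QCIdentification := fun _ hM => h hM

/-- Dropping (M) strengthens the crux. -/
theorem crux_of_withoutM (h : QCIdentificationWithoutM) : QCIdentification := fun hK _ => h hK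

/-- `¬ WithoutK` is `(M) ∧ ¬ target`: a `_false_without_K` theorem would settle two open problems. -/
theorem not_withoutK_iff :
    ¬ QCIdentificationWithoutK ↔
      (Summit.CriticalPhenomena.SAWScalingLimit.Theses.SAWDevelopingMap.InteriorFlattening ∧
        ¬ HexObservableLimit) := by
  unfold QCIdentificationWithoutK
  constructor
  · intro h
    by_contra h'
    exact h fun hM => by_contra fun hT => h' ⟨hM, hT⟩
  · rintro ⟨hM, hT⟩ h
    exact hT (h hM)

/-- `¬ WithoutM` is `(K) ∧ ¬ target`. -/
theorem not_withoutM_iff :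
    ¬ QCIdentificationWithoutM ↔
      (Summit.CriticalPhenomena.SAWScalingLimit.Theses.SAWDevelopingMap.NoFoldBound ∧
        ¬ HexObservableLimit) := by
  unfold QCIdentificationWithoutM
  constructor
  · intro h
    by_contra h'
    exact h fun hK => by_contra fun hT => h' ⟨hK, hT⟩
  · rintro ⟨hK, hT⟩ h
    exact hT (h hK)

/-! ## §3 Tightness of hypothesis (K): the fold threshold at the source vertex

At the source vertex of ANY simply connected domain the three port values are
`F(a) = 1`, `F(p_∓) = x_c e^{∓5πi/24} + L e^{∓5πi/6}` with `L = x_c Z_Λ ≥ 0` the returning-loop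
weight (rigid loop winding `±4π/3`), so the sum mode is `α_T - √3 L` and the Beltrami mode
`β_T + √3 L` (both real). Empirically (item 2 of the module docstring) this vertex is ALWAYS the
arg-max of the (K)-ratio. The algebra of the threshold: -/

/-- `α_T = 1 + 2 x_c cos(5π/24) = 1.85872…`, the sum mode of the bare source triple. -/
def alphaT : ℝ := 1 + 2 * hexCriticalFugacity * Real.cos (5 * Real.pi / 24)

/-- `β_T = 1 + 2 x_c cos(11π/24) = 1.14128…`, the Beltrami mode of the bare source triple. -/
def betaT : ℝ := 1 + 2 * hexCriticalFugacity * Real.cos (11 * Real.pi / 24)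

/-- The gap between the two modes: `α_T - β_T = 2 √3 · x_c · sin(π/8)` (sum-to-product). -/
theorem alphaT_sub_betaT :
    alphaT - betaT = 2 * Real.sqrt 3 * hexCriticalFugacity * Real.sin (Real.pi / 8) := by
  have h := Real.cos_sub_cos (5 * Real.pi / 24) (11 * Real.pi / 24)
  have e1 : (5 * Real.pi / 24 + 11 * Real.pi / 24) / 2 = Real.pi / 3 := by ring
  have e2 : (5 * Real.pi / 24 - 11 * Real.pi / 24) / 2 = -(Real.pi / 8) := by ring
  rw [e1, e2, Real.sin_neg, Real.sin_pi_div_three] at h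
  calc alphaT - betaT
      = 2 * hexCriticalFugacity * (Real.cos (5 * Real.pi / 24) - Real.cos (11 * Real.pi / 24)) := by
        unfold alphaT betaT; ring
    _ = 2 * hexCriticalFugacity * (-2 * (Real.sqrt 3 / 2) * -Real.sin (Real.pi / 8)) := by rw [h]
    _ = 2 * Real.sqrt 3 * hexCriticalFugacity * Real.sin (Real.pi / 8) := by ring

/-- **Source fold threshold.** With returning-loop weight `L` (so `L = x_c · Z`), the source triple
folds — Beltrami mode `β_T + √3 L` at least the sum mode `α_T - √3 L` — iff `L ≥ x_c sin(π/8)`,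
i.e. iff the critical returning-loop series `Z` reaches `sin(π/8) = 0.38268…`; equivalently the
no-fold inequality at the source is `L < x_c sin(π/8)`. (Census: `Z ≤ 0.098` enumerated,
`Z_∞ ≈ 0.12`.) -/
theorem source_noFold_iff (L : ℝ) :
    betaT + Real.sqrt 3 * L < alphaT - Real.sqrt 3 * L ↔
      L < hexCriticalFugacity * Real.sin (Real.pi / 8) := by
  have h3 : (0 : ℝ) < Real.sqrt 3 := Real.sqrt_pos.2 (by norm_num)
  have key := alphaT_sub_betaT
  constructor
  · intro h
    nlinarith
  · intro h
    nlinarith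

/-- The ratio form used in the census: for `√3 L < α_T` (true for every realisable `L`, since the
sum mode `α_T - √3 L = |Σ_ports F|·(phase)` is the modulus of a first-arrival-positive quantity),
`(β_T + √3 L)/(α_T - √3 L) < 1 ↔ L < x_c sin(π/8)`. -/
theorem source_ratio_lt_one_iff (L : ℝ) (hL : Real.sqrt 3 * L < alphaT) :
    (betaT + Real.sqrt 3 * L) / (alphaT - Real.sqrt 3 * L) < 1 ↔
      L < hexCriticalFugacity * Real.sin (Real.pi / 8) := by
  rw [div_lt_one (by linarith), source_noFold_iff]

/-! ## §4 `-- Targets`: line `eight_fifths_primitive`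

No stub is broken. Recorded for the lead (details in the module docstring):
* `stub_noBranching` — turning budget `Σ ext = 2π` exactly (corners of the source edge contribute
  `5π/8 + (3/8)ε` each); PL Gauss–Bonnet under (K) ⇒ no branching. 32.6·10⁶ instances checked.
* `stub_rayCondition` — the open content; its `RaySolution` growth clause is necessary (`G = Φ³`).
* `stub_boundaryAmplitude` — `κ ∈ ℝ` is forced by mirror symmetry of admissible data; fine.
Near-misses requiring an `Admissible` instance (not built this cycle): `¬ RayRigidity`-without-growth,
non-vacuity certificate of `Admissible`. -/

/-- Placeholder anchor for the `-- Targets` section: the registered stub signatures of the picked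
line, as one conjunction (so that a later cycle can state `stub_X_false : ¬ Sig.stub_X` against the
same names). Nothing is asserted. -/
def pickedLineStubs : Prop :=
  EightFifthsPrimitive.Sig.stub_noBranching ∧ EightFifthsPrimitive.Sig.stub_subsequentialLimits ∧
    EightFifthsPrimitive.Sig.stub_boundaryPhaseLaw ∧ EightFifthsPrimitive.Sig.stub_rayCondition ∧
      EightFifthsPrimitive.Sig.stub_rayRigidity ∧ EightFifthsPrimitive.Sig.stub_lateralUniversality ∧
        EightFifthsPrimitive.Sig.stub_boundaryAmplitude

/-- Joint sufficiency of the seven stubs is kernel-checked in the skeleton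
(`Lines/eight_fifths_primitive.lean`, `QCIdentification_of`, axioms standard); the glue
(`projectiveShape_of`, `hexObservableLimit_of`, `boundaryRigidity_of`) lives in that file, not in an
importable module, so it is not restated here. -/
example : pickedLineStubs → EightFifthsPrimitive.Sig.stub_rayCondition := fun h => h.2.2.2.1

end Summit.CriticalPhenomena.SAWScalingLimit.Cruxes.QCIdentification.Disproof
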